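/-
Copyright (c) 2026 the pub-hodgecm-mathlib formalisation cell (harness21).  Prover seat hodgecm-mathlib-K2E5-p10 (g4), Track B «K2-LIT» ∕ h413
(`stmt-HodgeConjecture-24833`), line `K2_E3_EllipticInputs`, unit U12, §L road «U-iso-T» brick (G⁺-b)/(K1′): THE BOCHNER TWISTED LINE PAIRING —
`∫_K χ(k) ∫_F ω(s) G_k(s) ds dκ = c ∫ g(X) · (∫_K χ(k) ω((k⁻¹Xk)₁₀) dκ) dμ𝔤(X)` for bounded weights and `g ∈ C_c`.  2026-09-04.
-/
import Summits.HodgeConjecture.HodgeConjecture.Theorems.K2E3GL2TwistedLineWeightPairing   -- ★ p857346 (this seat): chart constant kit, `conj_conj_inv`, `chart_apply_one_zero`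
import HarnessLib

/-!
# K2_E3 road (h413), §L brick (G⁺-b)/(K1′) — the Bochner twisted line pairing

Cell `pub/hodgecm-mathlib` (D-0151), Track B, seat K2E5-p10 (g4) (E3 §L line; §L lead K2E3-p12 (g4); (G⁺-b): line side K2E5-p17 (g3), `K`-side this seat).
`--supports stmt-HodgeConjecture-24833 --as helper`; THEOREMS ONLY (no definition ∕ instance ∕ notation ∕ named fact ∕ `sorry`); never imports `Cruxes/…/Lines`.
COUNT-NEUTRAL.

The signed (Bochner) twin of ★ p857346 `lintegral_twistedLineWeight_pairing`, in the currency of the line side's (L2)+(T2) (K2E5-p17 (g3), frozen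
04:26:40Z ∕ erratum 04:38:32Z): for a finite measure `κ` on `K = GL₂(𝒪)`, a bounded measurable `χ : K → ℂ`, a bounded measurable weight `ω : F → ℂ`
(e.g. `ω_n = χ̃·‖·‖⁻¹·1_{(𝔭^{2n})ᶜ}`), and `g ∈ C_c(𝔤𝔩₂(F))`,
  `∫_K χ(k) · ∫_F ω(s) · (∫_{F³} g(k [[r₀,r₁],[s,r₂]] k⁻¹) dr) ds dκ(k) = c · ∫ g(X) · (∫_K χ(k) ω((k⁻¹ X k)₁₀) dκ(k)) dμ𝔤(X)`
with ONE constant `c > 0` (**`integral_twistedLinePairing`**).  Steps: `F × F³ ≅ F⁴` (Fubini, `measurePreserving_piFinSuccAbove`); the chart `y ↦ [[y₁,y₂],[y₀,y₃]]`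
pushes `dx^{⊗4}` to `c⁻¹'μ𝔤` (Haar uniqueness, ★ p856988) — `integral_chart_eq_mul`; `Ad(k)` preserves `μ𝔤` (★ p856815); Fubini over `K × 𝔤𝔩₂`.
[HarishChandra1999AdmissibleDistributions, Lemma 5.2, §7] [LabesseLanglands1979, §2]
HONEST LABEL: HC_CM is proved only modulo the 7 printed citations (2 remaining named inputs: hLiu418 = stmt-HodgeConjecture-24832, h413 =
stmt-HodgeConjecture-24833) until rung 0 closes; count-neutral helper toward (LBU-2⁺)∕(G⁺-b), NOT ★.

## References
* [HarishChandra1999AdmissibleDistributions] Harish-Chandra (DeBacker–Sally), *Admissible Invariant Distributions on Reductive p-adic Groups* (1999), Lemma 5.2, §7.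
* [LabesseLanglands1979] J.-P. Labesse, R. P. Langlands, *L-indistinguishability for SL(2)*, Canad. J. Math. 31 (1979), §2.
-/

set_option autoImplicit false
set_option linter.dupNamespace false   -- `Summit.HodgeConjecture.HodgeConjecture.…` (D-0017 nested layout; lakefile exemption for Summits)

noncomputable section

open MeasureTheory Measure Filter Topology Set
open scoped MatrixGroups NNReal ENNReal Pointwise
open ValuativeRel
open Literature.NumberTheory.Automorphic Literature.NumberTheory.Automorphic.LocalFieldHaar
open Literature.NumberTheory.GaloisRepresentations Literature.NumberTheory.GaloisRepresentations.IsNonarchimedeanLocalField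
open Summit.HodgeConjecture.HodgeConjecture.Cruxes.H413.K2E3GL2RegularNilpotentFourierLineInversion
open Summit.HodgeConjecture.HodgeConjecture.Cruxes.H413.K2E3GLnLieAdIntegralInvariant
open Summit.HodgeConjecture.HodgeConjecture.Cruxes.H413.K2E3GL2TwistedLineWeightPairing

namespace Summit.HodgeConjecture.HodgeConjecture.Cruxes.H413.K2E3GL2TwistedLinePairingBochner

variable {F : Type*} [Field F] [ValuativeRel F] [TopologicalSpace F] [IsNonarchimedeanLocalField F]

section Chart
variable [MeasurableSpace F] [BorelSpace F] (dx : Measure F) [dx.IsAddHaarMeasure]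
  [MeasurableSpace (Matrix (Fin 2) (Fin 2) F)] [BorelSpace (Matrix (Fin 2) (Fin 2) F)] (μ𝔤 : Measure (Matrix (Fin 2) (Fin 2) F)) [μ𝔤.IsAddHaarMeasure]

/-- **The chart constant, Bochner form**: there is ONE `c > 0` with `chart_* dx^{⊗4} = c⁻¹ • μ𝔤`-type behaviour: for every `G` a.e.-strongly measurable w.r.t.
`μ𝔤`, `∫ G [[y₁,y₂],[y₀,y₃]] dx^{⊗4}(y) = c ∫ G dμ𝔤`, and `G ∘ chart` is `dx^{⊗4}`-integrable whenever `G` is `μ𝔤`-integrable.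
[cite: WeilBNT1967, Ch. I §2, Cor. 2 of Thm. 3] -/
theorem integral_chart_eq_mul :
    ∃ c : ℝ, 0 < c ∧
      (∀ G : Matrix (Fin 2) (Fin 2) F → ℂ, AEStronglyMeasurable G μ𝔤 →
        ∫ y : Fin 4 → F, G !![y 1, y 2; y 0, y 3] ∂(Measure.pi fun _ : Fin 4 => dx) = c * ∫ X, G X ∂μ𝔤) ∧
      (∀ G : Matrix (Fin 2) (Fin 2) F → ℂ, Integrable G μ𝔤 →
        Integrable (fun y : Fin 4 → F => G !![y 1, y 2; y 0, y 3]) (Measure.pi fun _ : Fin 4 => dx)) := by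
  haveI : T2Space F := (isLocalField F).toT2Space
  haveI : LocallyCompactSpace F := (isLocalField F).toLocallyCompactSpace
  haveI : SecondCountableTopology F := secondCountableTopology_localField F
  haveI : LocallyCompactSpace (Matrix (Fin 2) (Fin 2) F) := Pi.locallyCompactSpace_of_finite
  haveI : SecondCountableTopology (Matrix (Fin 2) (Fin 2) F) := inferInstanceAs (SecondCountableTopology (Fin 2 → Fin 2 → F))
  set ν : Measure (Matrix (Fin 2) (Fin 2) F) :=
    Measure.map (fun x : Fin 4 → F => (!![x 1, x 2; x 0, x 3] : Matrix (Fin 2) (Fin 2) F)) (Measure.pi fun _ : Fin 4 => dx) with hν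
  haveI : ν.IsAddHaarMeasure := isAddHaarMeasure_map_chart dx
  have huniq : μ𝔤 = μ𝔤.addHaarScalarFactor ν • ν := isAddLeftInvariant_eq_smul μ𝔤 ν
  set a : ℝ≥0 := μ𝔤.addHaarScalarFactor ν with ha
  have hapos : 0 < a := addHaarScalarFactor_pos_of_isAddHaarMeasure μ𝔤 ν
  have hνeq : ν = ((a⁻¹ : ℝ≥0) : ℝ≥0∞) • μ𝔤 := by
    rw [huniq, ENNReal.smul_def, smul_smul, ← ENNReal.coe_mul, inv_mul_cancel₀ hapos.ne', ENNReal.coe_one, one_smul]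
  have hchart : AEMeasurable (fun x : Fin 4 → F => (!![x 1, x 2; x 0, x 3] : Matrix (Fin 2) (Fin 2) F)) (Measure.pi fun _ : Fin 4 => dx) :=
    continuous_chart.measurable.aemeasurable
  refine ⟨((a⁻¹ : ℝ≥0) : ℝ), by exact_mod_cast inv_pos.2 hapos, fun G hG => ?_, fun G hG => ?_⟩
  · have hGν : AEStronglyMeasurable G ν := by rw [hνeq]; exact hG.smul_measure _
    have h1 := integral_map hchart (hν ▸ hGν)
    rw [← hν] at h1
    rw [← h1, hνeq, integral_smul_measure, ENNReal.coe_toReal]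
    rfl
  · have hGν : Integrable G ν := by rw [hνeq]; exact hG.smul_measure ENNReal.coe_ne_top
    exact (integrable_map_measure (hν ▸ hGν.aestronglyMeasurable) hchart).1 (hν ▸ hGν)

end Chart

section Pairing
variable [MeasurableSpace F] [BorelSpace F] (dx : Measure F) [dx.IsAddHaarMeasure]
  [MeasurableSpace (GL (Fin 2) F)] [BorelSpace (GL (Fin 2) F)]
  [MeasurableSpace (Matrix (Fin 2) (Fin 2) F)] [BorelSpace (Matrix (Fin 2) (Fin 2) F)] (μ𝔤 : Measure (Matrix (Fin 2) (Fin 2) F)) [μ𝔤.IsAddHaarMeasure]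

/-- **THE BOCHNER TWISTED LINE PAIRING.**  There is ONE constant `c > 0` (the chart constant) such that for every FINITE measure `κ` on `K = GL₂(𝒪)`, every
measurable `χ : K → ℂ` with `‖χ‖ ≤ 1`, every measurable weight `ω : F → ℂ` with `‖ω‖ ≤ M`, and every continuous compactly supported
`g : 𝔤𝔩₂(F) → ℂ`:
`∫_K χ(k) · ∫_F ω(s) · (∫_{F³} g(k [[r₀,r₁],[s,r₂]] k⁻¹) dr) ds dκ(k) = c · ∫ g(X) · (∫_K χ(k) ω((k⁻¹ X k)₁₀) dκ(k)) dμ𝔤(X)`.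
[cite: HarishChandra1999AdmissibleDistributions, Lemma 5.2, §7] [cite: LabesseLanglands1979, §2] -/
theorem integral_twistedLinePairing :
    ∃ c : ℝ, 0 < c ∧ ∀ (κ : Measure ↥(glInt 2 F)) [IsFiniteMeasure κ] (χ : ↥(glInt 2 F) → ℂ), Measurable χ → (∀ k, ‖χ k‖ ≤ 1) →
      ∀ (ω : F → ℂ) (M : ℝ), Measurable ω → (∀ s, ‖ω s‖ ≤ M) →
      ∀ g : Matrix (Fin 2) (Fin 2) F → ℂ, Continuous g → HasCompactSupport g →
        ∫ k : ↥(glInt 2 F), χ k * ∫ s : F, ω s *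
            ∫ r : Fin 3 → F, g (((k : GL (Fin 2) F) : Matrix (Fin 2) (Fin 2) F) * !![r 0, r 1; s, r 2] *
              ((((k : GL (Fin 2) F))⁻¹ : GL (Fin 2) F) : Matrix (Fin 2) (Fin 2) F)) ∂(Measure.pi fun _ : Fin 3 => dx) ∂dx ∂κ =
          c * ∫ X, g X * ∫ k : ↥(glInt 2 F), χ k *
            ω ((((((k : GL (Fin 2) F))⁻¹ : GL (Fin 2) F) : Matrix (Fin 2) (Fin 2) F) * X * ((k : GL (Fin 2) F) : Matrix (Fin 2) (Fin 2) F)) 1 0) ∂κ ∂μ𝔤 := by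
  haveI : T2Space F := (isLocalField F).toT2Space
  haveI : LocallyCompactSpace F := (isLocalField F).toLocallyCompactSpace
  haveI : SecondCountableTopology F := secondCountableTopology_localField F
  haveI : LocallyCompactSpace (Matrix (Fin 2) (Fin 2) F) := Pi.locallyCompactSpace_of_finite
  haveI : SecondCountableTopology (Matrix (Fin 2) (Fin 2) F) := inferInstanceAs (SecondCountableTopology (Fin 2 → Fin 2 → F))
  haveI : BorelSpace ↥(glInt 2 F) := Subtype.borelSpace _
  obtain ⟨c, hc, hchart, hint⟩ := integral_chart_eq_mul dx μ𝔤
  refine ⟨c, hc, fun κ _ χ hχm hχb ω M hωm hωb g hg hgs => ?_⟩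
  have hgint : Integrable g μ𝔤 := hg.integrable_of_hasCompactSupport hgs
  -- the entry map `(k, X) ↦ (k⁻¹ X k)₁₀` is continuous
  have hentry : Continuous fun p : ↥(glInt 2 F) × Matrix (Fin 2) (Fin 2) F =>
      ((((((p.1 : GL (Fin 2) F))⁻¹ : GL (Fin 2) F) : Matrix (Fin 2) (Fin 2) F) * p.2 * ((p.1 : GL (Fin 2) F) : Matrix (Fin 2) (Fin 2) F)) 1 0) := by
    refine (continuous_id.matrix_elem 1 0).comp ?_
    exact ((Units.continuous_coe_inv.comp (continuous_subtype_val.comp continuous_fst)).mul continuous_snd).mul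
      (Units.continuous_val.comp (continuous_subtype_val.comp continuous_fst))
  -- STEP 1: for each `k`, the inner double integral is the `dx^{⊗4}`-integral over the chart, then `c ∫ ω((k⁻¹Xk)₁₀) g(X) dμ𝔤`
  have hstep1 : ∀ k : ↥(glInt 2 F), ∫ s : F, ω s *
      ∫ r : Fin 3 → F, g (((k : GL (Fin 2) F) : Matrix (Fin 2) (Fin 2) F) * !![r 0, r 1; s, r 2] *
        ((((k : GL (Fin 2) F))⁻¹ : GL (Fin 2) F) : Matrix (Fin 2) (Fin 2) F)) ∂(Measure.pi fun _ : Fin 3 => dx) ∂dx =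
      c * ∫ X, ω ((((((k : GL (Fin 2) F))⁻¹ : GL (Fin 2) F) : Matrix (Fin 2) (Fin 2) F) * X * ((k : GL (Fin 2) F) : Matrix (Fin 2) (Fin 2) F)) 1 0) * g X ∂μ𝔤 := by
    intro k
    -- the function on `𝔤𝔩₂` whose chart pull-back is the integrand
    set G : Matrix (Fin 2) (Fin 2) F → ℂ := fun Y => ω (Y 1 0) *
      g (((k : GL (Fin 2) F) : Matrix (Fin 2) (Fin 2) F) * Y * ((((k : GL (Fin 2) F))⁻¹ : GL (Fin 2) F) : Matrix (Fin 2) (Fin 2) F)) with hGdef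
    have hgk_cont : Continuous fun Y : Matrix (Fin 2) (Fin 2) F =>
        g (((k : GL (Fin 2) F) : Matrix (Fin 2) (Fin 2) F) * Y * ((((k : GL (Fin 2) F))⁻¹ : GL (Fin 2) F) : Matrix (Fin 2) (Fin 2) F)) :=
      hg.comp (continuous_conj (k : GL (Fin 2) F))
    have hgk_int : Integrable (fun Y : Matrix (Fin 2) (Fin 2) F =>
        g (((k : GL (Fin 2) F) : Matrix (Fin 2) (Fin 2) F) * Y * ((((k : GL (Fin 2) F))⁻¹ : GL (Fin 2) F) : Matrix (Fin 2) (Fin 2) F))) μ𝔤 :=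
      ((measurePreserving_conj_of_mem_glInt μ𝔤 k.2).integrable_comp hgint.aestronglyMeasurable).2 hgint
    have hGm : AEStronglyMeasurable G μ𝔤 :=
      ((hωm.comp (continuous_id.matrix_elem 1 0).measurable).aestronglyMeasurable).mul hgk_cont.aestronglyMeasurable
    have hGint : Integrable G μ𝔤 :=
      hgk_int.bdd_mul (hωm.comp (continuous_id.matrix_elem 1 0).measurable).aestronglyMeasurable (Eventually.of_forall fun Y => hωb _)
    -- `F × F³ ≅ F⁴`
    have hmp := measurePreserving_piFinSuccAbove (fun _ : Fin 4 => dx) 0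
    set H : F × (Fin 3 → F) → ℂ := fun p => ω p.1 *
      g (((k : GL (Fin 2) F) : Matrix (Fin 2) (Fin 2) F) * !![p.2 0, p.2 1; p.1, p.2 2] *
        ((((k : GL (Fin 2) F))⁻¹ : GL (Fin 2) F) : Matrix (Fin 2) (Fin 2) F)) with hHdef
    have hHe : ∀ y : Fin 4 → F, H (MeasurableEquiv.piFinSuccAbove (fun _ : Fin 4 => F) 0 y) = G !![y 1, y 2; y 0, y 3] := by
      intro y
      simp only [hHdef, hGdef, MeasurableEquiv.piFinSuccAbove_apply, chart_apply_one_zero]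
      rfl
    have hHint : Integrable H (dx.prod (Measure.pi fun _ : Fin 3 => dx)) := by
      have h2 := hint G hGint
      rw [← (MeasurePreserving.integrable_comp_emb hmp (MeasurableEquiv.measurableEmbedding _))]
      · exact (integrable_congr (Eventually.of_forall fun y => (hHe y))).2 h2
    have hprod := integral_prod H hHint
    have hcomp := hmp.integral_comp' H
    simp_rw [hHe] at hcomp
    -- assemble
    have hlhs : ∫ s : F, ω s * ∫ r : Fin 3 → F, g (((k : GL (Fin 2) F) : Matrix (Fin 2) (Fin 2) F) * !![r 0, r 1; s, r 2] *
        ((((k : GL (Fin 2) F))⁻¹ : GL (Fin 2) F) : Matrix (Fin 2) (Fin 2) F)) ∂(Measure.pi fun _ : Fin 3 => dx) ∂dx =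
        ∫ s : F, ∫ r : Fin 3 → F, H (s, r) ∂(Measure.pi fun _ : Fin 3 => dx) ∂dx := by
      refine integral_congr_ae (Eventually.of_forall fun s => ?_)
      simp only [hHdef]
      exact (integral_const_mul _ _).symm
    rw [hlhs, ← hprod, ← hcomp, hchart G hGm]
    congr 1
    rw [← integral_comp_conj_of_mem_glInt μ𝔤 (inv_mem k.2) G]
    refine integral_congr_ae (Eventually.of_forall fun X => ?_)
    simp only [hGdef, inv_inv]
    rw [conj_conj_inv]
  have hL : ∫ k : ↥(glInt 2 F), χ k * ∫ s : F, ω s *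
      ∫ r : Fin 3 → F, g (((k : GL (Fin 2) F) : Matrix (Fin 2) (Fin 2) F) * !![r 0, r 1; s, r 2] *
        ((((k : GL (Fin 2) F))⁻¹ : GL (Fin 2) F) : Matrix (Fin 2) (Fin 2) F)) ∂(Measure.pi fun _ : Fin 3 => dx) ∂dx ∂κ =
      ∫ k : ↥(glInt 2 F), χ k * (c * ∫ X, ω ((((((k : GL (Fin 2) F))⁻¹ : GL (Fin 2) F) : Matrix (Fin 2) (Fin 2) F) * X *
        ((k : GL (Fin 2) F) : Matrix (Fin 2) (Fin 2) F)) 1 0) * g X ∂μ𝔤) ∂κ :=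
    integral_congr_ae (Eventually.of_forall fun k => congrArg (fun z : ℂ => χ k * z) (hstep1 k))
  rw [hL]
  -- STEP 2: Fubini over `K × 𝔤𝔩₂`
  have hI : Integrable (Function.uncurry fun (k : ↥(glInt 2 F)) (X : Matrix (Fin 2) (Fin 2) F) =>
      χ k * ω ((((((k : GL (Fin 2) F))⁻¹ : GL (Fin 2) F) : Matrix (Fin 2) (Fin 2) F) * X * ((k : GL (Fin 2) F) : Matrix (Fin 2) (Fin 2) F)) 1 0) * g X)
      (κ.prod μ𝔤) := by
    have h1 : Integrable (fun p : ↥(glInt 2 F) × Matrix (Fin 2) (Fin 2) F => (1 : ℂ) * g p.2) (κ.prod μ𝔤) :=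
      (integrable_const (1 : ℂ)).mul_prod hgint
    simp_rw [one_mul] at h1
    refine h1.bdd_mul (c := 1 * M) ?_ (Eventually.of_forall fun p => ?_)
    · exact ((hχm.comp measurable_fst).aestronglyMeasurable).mul (hωm.comp hentry.measurable).aestronglyMeasurable
    · rw [norm_mul]
      exact mul_le_mul (hχb _) (hωb _) (norm_nonneg _) zero_le_one
  have hswap := integral_integral_swap hI
  have hlhs2 : ∫ k : ↥(glInt 2 F), χ k * (c * ∫ X, ω ((((((k : GL (Fin 2) F))⁻¹ : GL (Fin 2) F) : Matrix (Fin 2) (Fin 2) F) * X *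
      ((k : GL (Fin 2) F) : Matrix (Fin 2) (Fin 2) F)) 1 0) * g X ∂μ𝔤) ∂κ =
      c * ∫ k : ↥(glInt 2 F), ∫ X, χ k * ω ((((((k : GL (Fin 2) F))⁻¹ : GL (Fin 2) F) : Matrix (Fin 2) (Fin 2) F) * X *
        ((k : GL (Fin 2) F) : Matrix (Fin 2) (Fin 2) F)) 1 0) * g X ∂μ𝔤 ∂κ := by
    rw [← integral_const_mul]
    refine integral_congr_ae (Eventually.of_forall fun k => ?_)
    simp only
    simp_rw [mul_assoc]
    rw [integral_const_mul]
    ring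
  rw [hlhs2, hswap]
  congr 1
  refine integral_congr_ae (Eventually.of_forall fun X => ?_)
  simp only
  rw [mul_comm (g X) _, ← integral_mul_const]

end Pairing

end Summit.HodgeConjecture.HodgeConjecture.Cruxes.H413.K2E3GL2TwistedLinePairingBochner

end
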